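/-
Copyright (c) 2026 the pub-hodgecm-mathlib formalisation cell (harness21).  Prover seat hodgecm-mathlib-LH4-p05 (g4): Track A «(D-RAM) FOUR-FRAME» squad of crux H413, the
(ρ2b′-X) payer ORDER v1 (`F0/P3c/LH4/LH4-p14/g3/RHO2BX-ORDER.v1.LH4p14g3.md`) — «T2b IN PLANE LETTERS» (LH4-p12 (g4) 2026-09-04T04:51:24Z «one T2-side brick still unnamed»), 2026-09-04.
-/
import Literature.NumberTheory.Automorphic.UnitaryLatticeTreeBlockGlueFibreCount   -- ★ T2b p857229 (LH4-p14 (g3)): `ncard_glueFibre_eq_natCard_normFibre` (the glue fibre over a W-part `B ⊆ W`, Fin-3 letters)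
import Literature.NumberTheory.Automorphic.UnitaryLatticeTreeBlockGlueFixed        -- ★ T2c p857252 (this seat): §3 plane bridge `ι_W` (`mem_map_planeMatrix_iff`, `pairing_endoShapeForm_plane`, `glueCondition_map_planeMatrix_iff_dualLatt_sup_span_eq`)
import HarnessLib

/-!
# The lattice graph of a hermitian space — THE GLUE FIBRE COUNT IN PLANE LETTERS: `#Fibre(ι_W(B₂), b) = #Sol_{2b}(r(w₀))` for a full plane lattice `B₂ = g₂·𝒪²` with
# `(B₂ ⊔ 𝒪w₀)^♯ = B₂` and `|⟨w₀, w₀⟩|·|ϖ|^{2b} = 1` (Jacobowitz 1962 §4; Bruhat–Tits 1972 §10; Kottwitz 1986 §1)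

Topic `NumberTheory/Automorphic`; namespace `Literature.NumberTheory.Automorphic.UnitaryLatticeTree`.  THEOREMS ONLY (no definition, no instance, no notation, no named fact,
no `sorry`); kernel lane `--supports stmt-HodgeConjecture-24833`; DATUM-FREE (`K` with `Valued K ℤᵐ⁰`, `𝒪` a PID, `σ` an isometric involution, `H₂` hermitian with unit determinant,
`|h| = 1`, `σh = h`; no `|2| = 1`, no `σϖ = ±ϖ`).  Cell `pub/hodgecm-mathlib`, crux H413 = `stmt-HodgeConjecture-24833`; squad F0∕P3c∕LH4, the WILD type-(2) G-side census (ρ2b′-X)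
of `Cruxes/H413/Lines/F0_P3c_DyRamFourFrame_U2H_HSide.lean` :418 (organ O-Cone: LH4-p12 (g4)'s cone∕level transport ★ p857402∕p857411 asks for the `g B₂ = …` half of its `hfg`).
HONEST LABEL: HC_CM is proved only modulo the 7 printed citations (hLiu418 = stmt-HodgeConjecture-24832, h413 = stmt-HodgeConjecture-24833) until rung 0 closes; lattice algebra only.

THE MATHEMATICS.  ★ T2b `ncard_glueFibre_eq_natCard_normFibre` counts the self-dual lattices `M` (block form `H = !![H₂ 0 0, 0, H₂ 0 1; 0, h, 0; H₂ 1 0, 0, H₂ 1 1]`) with a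
given `W`-part `M ∩ W = B` and tube coordinate `b ≥ 1` by the norm-residue set `Sol_{2b}(r) = {u mod 𝓂^{2b} : |uσu − r| ≤ |ϖ|^{2b}}`, `r = −⟨w₀, w₀⟩·ϖ^bσ(ϖ^b)∕h`, under FOUR
Fin-3 hypotheses on `(B, w₀)`: `B ⊆ W`, a frame `a₀·𝒪³ ≤ B ⊔ 𝒪·ϖ^b e₁`, `w₀ ∈ W`, and ★ T2a's gluing condition (G1).  When the `W`-part is given IN PLANE LETTERS — `B = ι_W(B₂)` for a
FULL plane lattice `B₂ = g₂·𝒪² ⊆ K²` and `w₀ = ι_W(w₀)`, `w₀ ∈ K²` — all four are discharged from TWO plane tokens: (G1) ⟺ `(B₂ ⊔ 𝒪w₀)^♯_{H₂} = B₂` (★ T2c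
`glueCondition_map_planeMatrix_iff_dualLatt_sup_span_eq`), `|⟨ι w₀, ι w₀⟩_H| = |⟨w₀, w₀⟩_{H₂}|` (★ T2c `pairing_endoShapeForm_plane`), `ι_W(B₂) ⊆ W` (★ T2c `mem_map_planeMatrix_iff`),
and the frame is `a₀ := ι(g₂, ϖ^b)` (`ι(g₂, ϖ^b)·v = ι_W(g₂·(v₀, v₂)) + v₁·ϖ^b e₁`).  So O-Cone's summand reads `#Fibre(ι_W(B₂), b) = #Sol_{2b}(−⟨w₀,w₀⟩_{H₂}·ϖ^bσ(ϖ^b)∕h)` for ANY `w₀`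
satisfying the two plane tokens — the `g B₂ = …` half of LH4-p12 (g4)'s `hfg` (its `… = f j (φ B₂)` half is ★ p857402 `map_glueNorm_eq`).

## References
* [Jacobowitz1962] R. Jacobowitz, *Hermitian forms over local fields*, Amer. J. Math. 84 (1962), §4.  [BruhatTits1972] F. Bruhat, J. Tits, *Groupes réductifs sur un corps local I*,
  Publ. Math. IHÉS 41 (1972), §10.  [Kottwitz1986BaseChangeUnits] R. E. Kottwitz, *Base change for unit elements of Hecke algebras*, Compositio Math. 60 (1986), §1 pp. 240–241.
-/

set_option autoImplicit false

noncomputable section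

open scoped Valued WithZero Matrix MatrixGroups

namespace Literature.NumberTheory.Automorphic.UnitaryLatticeTree

open Literature.NumberTheory.Automorphic Literature.NumberTheory.Automorphic.HermitianLattice Literature.NumberTheory.Rogawski1990

variable {K : Type*} [Field K] [Valued K ℤᵐ⁰]

/-! ## §1 The axis-scaled block frame `ι(g₂, ϖ^b)` lies in `ι_W(g₂·𝒪²) ⊔ 𝒪·ϖ^b e₁` -/

/-- **THE FRAME OF THE GLUED FIBRE IN PLANE LETTERS**: for `g₂ ∈ GL₂(K)` and `c ≠ 0`, the block frame `ι(g₂, c) = endoGL (g₂, [c])` has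
`ι(g₂, c)·𝒪³ ≤ ι_W(g₂·𝒪²) ⊔ 𝒪·(c e₁)` — indeed `ι(g₂, c)·v = ι_W(g₂·(v₀, v₂)) + v₁·(c e₁)` (the `a₀`-binder of ★ T2b at `c = ϖ^b`). [cite: BruhatTits1972, §10] [cite: Jacobowitz1962, §4] -/
theorem latt_endoGL_le_map_planeMatrix_sup_span_single (g₂ : GL (Fin 2) K) {c : K} (hc : c ≠ 0) :
    latt ((endoGL (g₂, Matrix.GeneralLinearGroup.mkOfDetNeZero (!![c] : Matrix (Fin 1) (Fin 1) K) (by rw [Matrix.det_fin_one_of]; exact hc)) : GL (Fin 3) K) :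
        Matrix (Fin 3) (Fin 3) K) ≤
      (latt (g₂ : Matrix (Fin 2) (Fin 2) K)).map ((Matrix.toLin' (!![1, 0; 0, 0; 0, 1] : Matrix (Fin 3) (Fin 2) K)).restrictScalars 𝒪[K]) ⊔
        Submodule.span 𝒪[K] {(Pi.single 1 c : Fin 3 → K)} := by
  rintro _ ⟨v, hv, rfl⟩
  rw [LinearMap.restrictScalars_apply, Matrix.toLin'_apply]
  have hv1 : Valued.v (v 1) ≤ 1 := (mem_stdLattice.1 hv) 1
  -- `ι(g₂, c)·v = ι_W(g₂·(v₀, v₂)) + v₁·(c e₁)`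
  have hsplit : ((endoGL (g₂, Matrix.GeneralLinearGroup.mkOfDetNeZero (!![c] : Matrix (Fin 1) (Fin 1) K) (by rw [Matrix.det_fin_one_of]; exact hc)) : GL (Fin 3) K) :
        Matrix (Fin 3) (Fin 3) K) *ᵥ v =
      (![((g₂ : Matrix (Fin 2) (Fin 2) K) *ᵥ ![v 0, v 2]) 0, 0, ((g₂ : Matrix (Fin 2) (Fin 2) K) *ᵥ ![v 0, v 2]) 1] : Fin 3 → K) +
        (v 1) • (Pi.single 1 c : Fin 3 → K) := by
    rw [coe_endoGL_eq_endoShape, Matrix.GeneralLinearGroup.val_mkOfDetNeZero]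
    ext i
    fin_cases i <;> simp [Matrix.mulVec, dotProduct, Fin.sum_univ_three, Fin.sum_univ_two, mul_comm]
  rw [hsplit]
  refine Submodule.add_mem _ (Submodule.mem_sup_left ?_) (Submodule.mem_sup_right ?_)
  · refine ⟨(g₂ : Matrix (Fin 2) (Fin 2) K) *ᵥ ![v 0, v 2], mulVec_mem_latt _ (mem_stdLattice.2 fun i => ?_), ?_⟩
    · fin_cases i
      · simpa using (mem_stdLattice.1 hv) 0
      · simpa using (mem_stdLattice.1 hv) 2
    · rw [LinearMap.restrictScalars_apply, Matrix.toLin'_apply, planeMatrix_mulVec]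
  · have e : (v 1) • (Pi.single 1 c : Fin 3 → K) = ((⟨v 1, (mem_integer_iff' _).2 hv1⟩ : 𝒪[K]) • (Pi.single 1 c : Fin 3 → K)) := rfl
    rw [e]
    exact Submodule.smul_mem _ _ (Submodule.mem_span_singleton_self _)

/-! ## §2 The glue fibre count in plane letters -/

/-- **THE PLANE GLUING TOKEN, TWO SPELLINGS** (any rank): `(B₂ ⊔ 𝒪w₀)^♯ = B₂ ⟺ ∀ w, (w ∈ B₂ ↔ w ∈ B₂^♯ ∧ |⟨w₀, w⟩| ≤ 1)` — ★ `mem_dualLatt_sup_span_iff` ∕ ★ `mem_dualLatt`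
elementwise; the right-hand spelling is the index-set letter of the O-Cone assembly (LH4-p07 (g6) §5, LH4-p12 (g4) ★ p857411), the left-hand one is ★ T2c's and §2's `hG1`.
[cite: Jacobowitz1962, §4] [cite: BruhatTits1972, §10] -/
theorem dualLatt_sup_span_eq_iff_forall_mem_iff {N : ℕ} {σ : K →+* K} (hvσ : ∀ a, Valued.v (σ a) = Valued.v a) (H₂ : Matrix (Fin N) (Fin N) K)
    (B₂ : Submodule 𝒪[K] (Fin N → K)) (w₀ : Fin N → K) :
    dualLatt σ H₂ (B₂ ⊔ Submodule.span 𝒪[K] {w₀}) = B₂ ↔ ∀ w : Fin N → K, w ∈ B₂ ↔ (w ∈ dualLatt σ H₂ B₂ ∧ Valued.v (pairing σ H₂ w₀ w) ≤ 1) := by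
  constructor
  · intro h w
    rw [← h, mem_dualLatt_sup_span_iff hvσ, mem_dualLatt, h]
  · intro h
    ext w
    rw [mem_dualLatt_sup_span_iff hvσ, ← mem_dualLatt, h w]


/-- **THE GLUE FIBRE COUNT IN PLANE LETTERS.**  Block form `H` (`σ` an isometric involution, `H₂` hermitian with unit determinant, `|h| = 1`, `σh = h`, `𝒪` a PID), tube level
`b ≥ 1`; a FULL plane lattice `B₂ = g₂·𝒪² ⊆ K²` and a plane vector `w₀` with the two PLANE TOKENS (G1) `(B₂ ⊔ 𝒪w₀)^♯_{H₂} = B₂` and `|⟨w₀, w₀⟩_{H₂}|·|ϖ|^{2b} = 1`.  Then the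
self-dual lattices `M ⊆ K³` with `W`-part `M ∩ W = ι_W(B₂)` and tube coordinate `b` (`c·e₁ ∈ M ⟺ |c| ≤ |ϖ|^b`) are counted by the norm-residue set:
`#{M} = #{x ∈ 𝒪∕𝓂^{2b} : ∃ u ↦ x, |uσu − r| ≤ |ϖ^{2b}|}`, `r = −⟨w₀, w₀⟩_{H₂}·ϖ^bσ(ϖ^b)∕h` — ★ T2b `ncard_glueFibre_eq_natCard_normFibre` at `B := ι_W(B₂)`, `w₀ := ι_W w₀`, its four
Fin-3 binders discharged by ★ T2c's plane bridge and the frame `ι(g₂, ϖ^b)` of §1. [cite: Jacobowitz1962, §4] [cite: BruhatTits1972, §10] [cite: Kottwitz1986BaseChangeUnits, §1 pp. 240–241] -/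
theorem ncard_glueFibre_map_planeMatrix_eq_natCard_normFibre [IsPrincipalIdealRing 𝒪[K]] (σ : K →+* K) (hσ : ∀ a, σ (σ a) = a) (hvσ : ∀ a, Valued.v (σ a) = Valued.v a)
    {ϖ : K} (hϖ : Valued.v ϖ = WithZero.exp (-1 : ℤ))
    {H₂ : Matrix (Fin 2) (Fin 2) K} (hH₂ : IsUnit H₂.det) (hH₂σ : (H₂.map σ)ᵀ = H₂) {h : K} (hh : Valued.v h = 1) (hhσ : σ h = h)
    {B₂ : Submodule 𝒪[K] (Fin 2 → K)} (g₂ : GL (Fin 2) K) (hBg : B₂ = latt (g₂ : Matrix (Fin 2) (Fin 2) K)) {b : ℕ} (hb1 : 1 ≤ b)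
    {w₀ : Fin 2 → K} (hG1 : dualLatt σ H₂ (B₂ ⊔ Submodule.span 𝒪[K] {w₀}) = B₂) (hw₀ : Valued.v (pairing σ H₂ w₀ w₀) * Valued.v ϖ ^ (2 * b) = 1) :
    {M : Submodule 𝒪[K] (Fin 3 → K) | IsSelfDualLattice σ ϖ (!![H₂ 0 0, 0, H₂ 0 1; 0, h, 0; H₂ 1 0, 0, H₂ 1 1] : Matrix (Fin 3) (Fin 3) K) M ∧
        M ⊓ LinearMap.ker ((LinearMap.proj (1 : Fin 3) : (Fin 3 → K) →ₗ[K] K).restrictScalars 𝒪[K]) =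
          B₂.map ((Matrix.toLin' (!![1, 0; 0, 0; 0, 1] : Matrix (Fin 3) (Fin 2) K)).restrictScalars 𝒪[K]) ∧
        ∀ c : K, (Pi.single 1 c : Fin 3 → K) ∈ M ↔ Valued.v c ≤ Valued.v ϖ ^ b}.ncard =
      Nat.card {x : 𝒪[K] ⧸ 𝓂[K] ^ (2 * b) // ∃ u : 𝒪[K], Ideal.Quotient.mk (𝓂[K] ^ (2 * b)) u = x ∧
        Valued.v ((u : K) * σ u - (-(pairing σ H₂ w₀ w₀) * (ϖ ^ b * σ (ϖ ^ b)) / h)) ≤ Valued.v (ϖ ^ (2 * b))} := by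
  have hϖ0' : Valued.v ϖ ≠ 0 := by rw [hϖ]; exact WithZero.exp_ne_zero
  have hϖ0 : ϖ ≠ 0 := fun h0 => by rw [h0, map_zero] at hϖ0'; exact hϖ0' rfl
  have hc : ϖ ^ b ≠ 0 := pow_ne_zero _ hϖ0
  -- the four Fin-3 binders of ★ T2b, from the plane tokens
  have hBW : ∀ y ∈ B₂.map ((Matrix.toLin' (!![1, 0; 0, 0; 0, 1] : Matrix (Fin 3) (Fin 2) K)).restrictScalars 𝒪[K]), y 1 = 0 :=
    fun y hy => ((mem_map_planeMatrix_iff B₂ y).1 hy).1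
  have ha₀ := latt_endoGL_le_map_planeMatrix_sup_span_single g₂ hc
  rw [← hBg] at ha₀
  have hx₀ : (![w₀ 0, 0, w₀ 1] : Fin 3 → K) - Pi.single 1 ((![w₀ 0, 0, w₀ 1] : Fin 3 → K) 1) = ![w₀ 0, 0, w₀ 1] := by simp
  have hG1' := (glueCondition_map_planeMatrix_iff_dualLatt_sup_span_eq hvσ H₂ h B₂ hx₀).2 hG1
  have hw₀' : Valued.v (pairing σ (!![H₂ 0 0, 0, H₂ 0 1; 0, h, 0; H₂ 1 0, 0, H₂ 1 1] : Matrix (Fin 3) (Fin 3) K) ![w₀ 0, 0, w₀ 1] ![w₀ 0, 0, w₀ 1]) *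
      Valued.v ϖ ^ (2 * b) = 1 := by rw [pairing_endoShapeForm_plane]; exact hw₀
  have key := ncard_glueFibre_eq_natCard_normFibre σ hσ hvσ hϖ hH₂ hH₂σ hh hhσ hBW hb1 _ ha₀ (by simp) hG1' hw₀'
  rw [pairing_endoShapeForm_plane] at key
  exact key

end Literature.NumberTheory.Automorphic.UnitaryLatticeTree

end
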